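import Summits.BirchSwinnertonDyer.Rank1Residual.P2.CMKolyvaginCMIsogenyAtTwo
import HarnessLib

/-!
# `P2` typed interface (cell `bsd-print-cf2`, seat ty2): `η_*` PRESERVES `Sel_{2^M}(E_K/K)` and the EXACT
# SELMER SPLITTING `#Sel_{2^M}(E_K/K) = (#Sel_{2^M}(E_K/K)^{σ})²` on `H₂` — WITHOUT the binder `hloc`

Route `CMKolyvaginAtInertTwo`, crux `CMKolyvaginExactAtInertTwo` (stmt-BirchSwinnertonDyer-24277);
MEMO `Cruxes/CMExactDescentAtTwo/MEMO-inert-order-splitting.md` §5 stub **S1** («`η_*` preserves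
`Sel_{2^M}(E/L)`: needs `η` as an `L`-rational isogeny acting on local points») and KERNEL-STATUS v9 §9
(d). THEOREMS ONLY (0 defs / 0 facts / 0 sorry); no item is closed; BSD is not proved by this.

cmk2-p1 g10's `InertOrderSplittingHabitat.natCard_selmer_eq_sq_of_hasLocalPointsMaps` reduces S1 to the
displayed input `hloc : ∀ η m c, η² + mη = c → Γ_K-equivariant → HasLocalPointsMaps (W⁄K) (W⁄K) η`.
The sibling file `CMKolyvaginCMIsogenyAtTwo.lean` produces the CM generator on all of `H₂` as a term
`η : Isogeny (W⁄K) (W⁄K)`; an isogeny defined over `K` has local points maps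
(`WeierstrassCurve.Isogeny.hasLocalPointsMaps_toAddMonoidHom`, tree, proved), so:

* `resH1Hom_mem_selmerGroup_of_isogeny` — **S1 for isogenies**: for ANY isogeny `η : E → E` defined
  over a number field `K`, `η_*` maps `Sel_n(E/K)` into itself (cmk2's
  `resH1Hom_mem_selmerGroup_of_hasLocalPointsMaps` with the local points maps supplied).
* `exists_cmIsogeny_selmerStable_of_cmInert_two` — on `H₂` (`HasCM ∧ CMInert W 2 ∧ ρ̄₂ onto`), for every
  number field `K ∋ √d_F` and every `M`: a `K`-isogeny `η` of `E_K` with `η² + (2k₀+1)η = c`, `c` odd,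
  `Γ_K`-equivariant, with a restriction `ηn` to `E_K[2^M]` such that `η_* = resH1Hom id ηn` preserves
  `Sel_{2^M}(E_K/K)`.
* `natCard_selmer_eq_sq` — **`#Sel_{2^M}(E_K/K) = (#Sel_{2^M}(E_K/K)^{σ})²`** for totally complex
  `K ∋ √d_F`, an involution `σ` of `K` lifted by a transported complex conjugation and a `3`-cycle
  `z ∈ ρ̄₂(Γ_K)` — cmk2's statement with the binder `hloc` GONE (package: cmk2's
  `natCard_stable_eq_sq_of_complexConjugation` applied to the isogeny-generator).

beyond-print theorem: NO (Milne *ADT* I.§6–7: isogenies act on `Ш`/Selmer; Lang Ch. 10 §4 Remark).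
BSD is not proved by any of this; no summit statement is proved by this seat.

References: J. S. Milne, *Arithmetic Duality Theorems* (2006), I.§6–7 [MilneADT2006]; J. H. Silverman,
*AEC* (2009), III.§4, X.§4 [SilvermanAEC2009]; S. Lang, *Elliptic Functions* (1987), Ch. 10 §4 [Lang1987].
-/

set_option autoImplicit false

noncomputable section

open scoped Classical

namespace Summit.BirchSwinnertonDyer.Rank1Residual.P2.CMIsogenyAtTwo

open WeierstrassCurve Field NumberField
open Literature.NumberTheory.EllipticCurves Literature.NumberTheory.EllipticCurves.Rank1Residual
open Literature.NumberTheory.GaloisRepresentations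
open Summit.BirchSwinnertonDyer.Rank1Residual Summit.BirchSwinnertonDyer.Rank1Residual.P2
open Summit.BirchSwinnertonDyer.Rank1Residual.P2.CartanAtTwo
open Summit.BirchSwinnertonDyer.BirchSwinnertonDyer.Theorems.KolyvaginEigenTwo
open Summit.BirchSwinnertonDyer.BirchSwinnertonDyer.Theorems.InertOrderSplittingHabitat

universe u

/-! ## §5 `η_*` preserves the Selmer group for an isogeny `η` — MEMO stub S1 -/

section Selmer

/-- **`η_*` PRESERVES `Sel_n(E/K)` FOR AN ISOGENY `η : E → E` DEFINED OVER THE NUMBER FIELD `K`**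
(MEMO §5 stub S1 in its honest generality): an isogeny has local points maps
(`Isogeny.hasLocalPointsMaps_toAddMonoidHom`), so cmk2's `resH1Hom_mem_selmerGroup_of_hasLocalPointsMaps`
applies — `Sel_n` is the preimage of `Ш` under `H¹(K, E[n]) → H¹(K, E)` and `H¹(η)` preserves `Ш`.
[cite: MilneADT2006, I.§7 (proof of Lemma 7.1)] [cite: SilvermanAEC2009, X.§4] -/
theorem resH1Hom_mem_selmerGroup_of_isogeny {K : Type u} [Field K] [NumberField K]
    (V : WeierstrassCurve K) (n : ℤ) (η : Isogeny V V)
    (ηn : geomTorsion V n →+ geomTorsion V n) (hηn : ∀ P : geomTorsion V n, (ηn P : geomPoints V) = η P)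
    (hηnG : ∀ (x : absoluteGaloisGroup K) (P : geomTorsion V n),
      ηn (ContinuousMonoidHom.id (absoluteGaloisGroup K) x • P) = x • ηn P)
    {x : galH1Torsion V n} (hx : x ∈ selmerGroup V n) :
    resH1Hom (ContinuousMonoidHom.id _) ηn hηnG x ∈ selmerGroup V n :=
  resH1Hom_mem_selmerGroup_of_hasLocalPointsMaps V n η.toAddMonoidHom η.equivariant
    η.hasLocalPointsMaps_toAddMonoidHom ηn hηn hηnG hx

variable (W : WeierstrassCurve ℚ) [W.IsElliptic] {K : Type} [Field K] [NumberField K]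

/-- **On `H₂`: a Selmer-stable CM isogeny at every level `2^M`.** For `E/ℚ` with CM, `2` inert in the CM
field, `ρ̄_{E,2}` onto, and a number field `K ∋ √d_F`: there are `k₀`, an odd `c`, a `K`-isogeny `η` of
`E_K` with `η(ηQ) + (2k₀+1)·ηQ = c·Q`, commuting with `Γ_K`, and for every `M` a restriction `ηn` of `η`
to `E_K[2^M]` whose `η_* = resH1Hom id ηn` maps `Sel_{2^M}(E_K/K)` into itself.
[cite: Lang1987, Ch. 10 §4, Remark] [cite: MilneADT2006, I.§7 (proof of Lemma 7.1)] -/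
theorem exists_cmIsogeny_selmerStable_of_cmInert_two (hCM : W.HasCM) (hin : CMInert W 2)
    (hsurj : W.HasSurjectiveModNGaloisRep 2) (hF : IsSquare (algebraMap ℚ K (cmFieldDiscrOfJ W.j)))
    (M : ℕ) :
    ∃ (k₀ c : ℤ) (η : Isogeny (W.baseChange K) (W.baseChange K)), Odd c ∧
      (∀ Q : geomPoints (W.baseChange K), η (η Q) + (2 * k₀ + 1) • η Q = c • Q) ∧
      (∀ (γ : absoluteGaloisGroup K) (Q : geomPoints (W.baseChange K)), γ • η Q = η (γ • Q)) ∧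
      ∃ ηn : geomTorsion (W.baseChange K) ((2 : ℤ) ^ M) →+ geomTorsion (W.baseChange K) ((2 : ℤ) ^ M),
        ∃ hηnG : ∀ (x : absoluteGaloisGroup K) (P : geomTorsion (W.baseChange K) ((2 : ℤ) ^ M)),
            ηn (ContinuousMonoidHom.id (absoluteGaloisGroup K) x • P) = x • ηn P,
          (∀ P : geomTorsion (W.baseChange K) ((2 : ℤ) ^ M),
            (ηn P : geomPoints (W.baseChange K)) = η P) ∧
          ∀ x ∈ selmerGroup (W.baseChange K) ((2 : ℤ) ^ M),
            resH1Hom (ContinuousMonoidHom.id _) ηn hηnG x ∈ selmerGroup (W.baseChange K) ((2 : ℤ) ^ M) := by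
  obtain ⟨k₀, c, η, hc, hrel⟩ := exists_cmIsogeny_baseChange_of_cmInert_two W hCM hin hsurj K hF
  have hη : ∀ (γ : absoluteGaloisGroup K) (Q : geomPoints (W.baseChange K)), γ • η Q = η (γ • Q) :=
    fun γ Q ↦ (η.equivariant γ Q).symm
  obtain ⟨ηn, hηn, hηnG⟩ :=
    exists_torsionRestrict (W.baseChange K) (η.toAddMonoidHom : AddMonoid.End _) hη ((2 : ℤ) ^ M)
  exact ⟨k₀, c, η, hc, hrel, hη, ηn, hηnG, hηn, fun x hx ↦
    resH1Hom_mem_selmerGroup_of_isogeny (W.baseChange K) _ η ηn hηn hηnG hx⟩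

variable {σ : K ≃ₐ[ℚ] K} {c₀ : absoluteGaloisGroup ℚ}

/-- **`#Sel_{2^M}(E_K/K) = (#Sel_{2^M}(E_K/K)^{σ})²` ON `H₂` — cmk2's `natCard_selmer_eq_sq_of_hasLocalPointsMaps`
WITH THE BINDER `hloc` DISCHARGED.** For `E/ℚ` with CM, `2` inert in the CM field, `ρ̄_{E,2}` onto; `K` a
totally complex number field containing `√d_F`; `σ ∈ Aut(K/ℚ)` an involution lifted by the transport of a
complex conjugation `c₀`; `z ∈ Γ_K` without non-zero fixed point on `E_K[2]`: for every `M`,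
`#Sel_{2^M}(E_K/K) = (#{x ∈ Sel_{2^M}(E_K/K) | σ_* x = x})²`. The Selmer group is `σ_*`-stable
(`conjAct_mem_selmerGroup`, `K` totally complex) and `η_*`-stable for the ISOGENY generator `η`
(§5), so cmk2's package `natCard_stable_eq_sq_of_complexConjugation` applies to `S = Sel_{2^M}`.
[cite: Lang1987, Ch. 10 §4, Remark] [cite: MilneADT2006, I.§7] -/
theorem natCard_selmer_eq_sq (hCM : W.HasCM) (hin : CMInert W 2)
    (hsurj : W.HasSurjectiveModNGaloisRep 2) (hK : ∀ w : InfinitePlace K, w.IsComplex)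
    (hF : IsSquare (algebraMap ℚ K (cmFieldDiscrOfJ W.j)))
    (hc₀ : IsComplexConjugation (Rat.castHom ℝ) c₀) (hσ : σ * σ = 1)
    (hτ : IsLiftOfAut σ (absGaloisTransport (K := ℚ) (L := K) c₀).toRingEquiv)
    {z : absoluteGaloisGroup K}
    (hz : ∀ P : geomPoints (W.baseChange K), (2 : ℤ) • P = 0 → z • P = P → P = 0)
    (M : ℕ) :
    Nat.card (selmerGroup (W.baseChange K) ((2 : ℤ) ^ M)) =
      Nat.card {x : selmerGroup (W.baseChange K) ((2 : ℤ) ^ M) //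
        conjAct W σ _ (x : galH1Torsion (W.baseChange K) ((2 : ℤ) ^ M)) = x} ^ 2 := by
  have hΔ : W.Δ < 0 := Δ_neg_of_cmInert_two W hCM hin hsurj
  obtain ⟨k₀, c, η, hc, hrel, hη, ηn, hηnG, hηn, hSel⟩ :=
    exists_cmIsogeny_selmerStable_of_cmInert_two W hCM hin hsurj hF M
  exact natCard_stable_eq_sq_of_complexConjugation W hΔ hc₀ hσ hτ (η := η.toAddMonoidHom) hrel hc hη hz
    M ηn hηn hηnG (selmerGroup (W.baseChange K) ((2 : ℤ) ^ M))
    (fun x hx ↦ conjAct_mem_selmerGroup W hK σ _ hx) hSel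

/-- **`Sel_{2^M}(E_K/K)^{σ} = (1 + σ_*) Sel_{2^M}(E_K/K)`-half: every `σ_*`-fixed Selmer class is
`y + σ_* y`** for some `y ∈ H¹(K, E_K[2^M])` (cmk2's `fixed_iff_exists_add_conjAct_of_complexConjugation`
fed with the isogeny generator; `Ĥ⁰(⟨σ⟩, H¹) = 0`). [cite: Lang1987, Ch. 10 §4, Remark] -/
theorem selmer_fixed_iff_exists_add_conjAct (hCM : W.HasCM) (hin : CMInert W 2)
    (hsurj : W.HasSurjectiveModNGaloisRep 2) (hF : IsSquare (algebraMap ℚ K (cmFieldDiscrOfJ W.j)))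
    (hc₀ : IsComplexConjugation (Rat.castHom ℝ) c₀) (hσ : σ * σ = 1)
    (hτ : IsLiftOfAut σ (absGaloisTransport (K := ℚ) (L := K) c₀).toRingEquiv)
    {z : absoluteGaloisGroup K}
    (hz : ∀ P : geomPoints (W.baseChange K), (2 : ℤ) • P = 0 → z • P = P → P = 0)
    (M : ℕ) (x : galH1Torsion (W.baseChange K) ((2 : ℤ) ^ M)) :
    conjAct W σ _ x = x ↔ ∃ y, x = y + conjAct W σ _ y := by
  have hΔ : W.Δ < 0 := Δ_neg_of_cmInert_two W hCM hin hsurj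
  obtain ⟨k₀, c, η, hc, hrel, hη, ηn, hηnG, hηn, -⟩ :=
    exists_cmIsogeny_selmerStable_of_cmInert_two W hCM hin hsurj hF M
  exact fixed_iff_exists_add_conjAct_of_complexConjugation W hΔ hc₀ hσ hτ (η := η.toAddMonoidHom) hrel hc
    hη hz M ηn hηn hηnG x

end Selmer

end Summit.BirchSwinnertonDyer.Rank1Residual.P2.CMIsogenyAtTwo
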